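import Summits.Ventures.DiscreteObjects.Hadamard.ConferenceGraph333OrderSummary
import Summits.Ventures.DiscreteObjects.Hadamard.ConferenceGraph333Order13
import Summits.Ventures.DiscreteObjects.Hadamard.ConferenceGraph333PGroupFixed
import Summits.Ventures.DiscreteObjects.Hadamard.ConferenceGraph333OrderCensusD

/-!
# Orders of automorphisms of srg(333,166,82,83), gen-30 summary: orderOf σ ∣ 2⁶·3³·5·7·11·37·41·83 (kernel)

Framing: lottery ticket; floor = certified bounds/negative ranges.  Cell pub-namedobj (venture DiscreteObjects),
target (H) = `H(668)`, hadamard gen 30.  One-statement packaging (in `orderOf` form, as in gen 29's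
`ConferenceGraph333OrderSummary`) of the element-order census after gen 30 (`ConferenceGraph333FixedSubgraph`,
`…Order13`, `…PGroupFixed`, `…OrderCensusD`): for every adjacency-preserving permutation `σ` of an `srg(333,166,82,83)`
* `aut_prime_dvd_orderOf_g30` — every prime divisor of `orderOf σ` lies in `{2, 3, 5, 7, 11, 37, 41, 83}`;
* `aut_orderOf_not_dvd_g30` — `m ∤ orderOf σ` for `m ∈ {13, 23, 25, 55, 77, 81, 105, 1369, 1681, 6889}` (new in gen 30;
  `37², 41², 83²` by the prime-power orbit bound `p²·(f+1) ≤ 333` of gen 29), in addition to gen 29's 34 values;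
* **`aut_orderOf_dvd_g30`** — **`orderOf σ ∣ 2⁶ · 3³ · 5 · 7 · 11 · 37 · 41 · 83`** (`= 83 766 070 080`): prime by prime
  through `Nat.dvd_iff_prime_pow_dvd_dvd` (`2⁷ = 128`, `3⁴ = 81`, `5²`, `7²`, `11²`, `37²`, `41²`, `83²` do not divide).
Script level (exact, all kernel laws; code/order_census_g30.py): the admissible orders are 54 values `≤ 166`.
WORDS: structure of a HYPOTHETICAL object; ours (PROVISIONAL).  No `sorry`, no new definitions.
-/

namespace Summit.Ventures.DiscreteObjects.Hadamard

open Finset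

section ordersummary30
variable {V : Type*} [Fintype V] [DecidableEq V]

/-- **Prime divisors of `orderOf σ` (gen 30): `p ∈ {2,3,5,7,11,37,41,83}`.** -/
theorem aut_prime_dvd_orderOf_g30 (hV : Fintype.card V = 333) (A : Matrix V V ℤ)
    (h01 : ∀ x y, A x y = 0 ∨ A x y = 1) (hsymm : ∀ x y, A y x = A x y) (hdiag : ∀ x, A x x = 0)
    (hk : ∀ x, ∑ y, A x y = 166) (hsrg : ∀ x y, ∑ z, A x z * A z y = 83 * (1 + (if x = y then 1 else 0)) - A x y)
    (σ : Equiv.Perm V) (hA : ∀ x y, A (σ x) (σ y) = A x y) {p : ℕ} (hp : p.Prime) (hdvd : p ∣ orderOf σ) :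
    p = 2 ∨ p = 3 ∨ p = 5 ∨ p = 7 ∨ p = 11 ∨ p = 37 ∨ p = 41 ∨ p = 83 := by
  have hAk := adj_pow_invariant A σ hA
  obtain ⟨h1, hne⟩ := pow_orderOf_div_facts σ hdvd
  have hne1 : σ ^ (orderOf σ / p) ≠ 1 := by
    have := hne 1 one_pos hp.one_lt
    rwa [pow_one] at this
  exact aut_prime_spectrum_g30 hV A h01 hsymm hdiag hk hsrg hp _ h1 hne1 (hAk _)

/-- **Excluded divisors of `orderOf σ`, gen-30 additions.** -/
theorem aut_orderOf_not_dvd_g30 (hV : Fintype.card V = 333) (A : Matrix V V ℤ)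
    (h01 : ∀ x y, A x y = 0 ∨ A x y = 1) (hsymm : ∀ x y, A y x = A x y) (hdiag : ∀ x, A x x = 0)
    (hk : ∀ x, ∑ y, A x y = 166) (hsrg : ∀ x y, ∑ z, A x z * A z y = 83 * (1 + (if x = y then 1 else 0)) - A x y)
    (σ : Equiv.Perm V) (hA : ∀ x y, A (σ x) (σ y) = A x y) {m : ℕ}
    (hm : m ∈ ({13, 23, 25, 55, 77, 81, 105, 1369, 1681, 6889} : Finset ℕ)) : ¬ m ∣ orderOf σ := by
  intro hdvd
  have hAk := adj_pow_invariant A σ hA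
  obtain ⟨h1, hne⟩ := pow_orderOf_div_facts σ hdvd
  simp only [Finset.mem_insert, Finset.mem_singleton] at hm
  rcases hm with rfl | rfl | rfl | rfl | rfl | rfl | rfl | rfl | rfl | rfl
  · exact no_aut_order_13 hV A h01 hsymm hdiag hk hsrg (σ ^ (orderOf σ / 13)) h1 (by
      have := hne 1 one_pos (by norm_num); rwa [pow_one] at this) (hAk _)
  · exact no_aut_order_23 hV A h01 hsymm hdiag hk hsrg (σ ^ (orderOf σ / 23)) h1 (by
      have := hne 1 one_pos (by norm_num); rwa [pow_one] at this) (hAk _)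
  · exact no_aut_order_25 hV A h01 hsymm hdiag hk hsrg (σ ^ (orderOf σ / 25)) h1 (hne 5 (by norm_num) (by norm_num)) (hAk _)
  · exact no_aut_order_55 hV A h01 hsymm hdiag hk hsrg (σ ^ (orderOf σ / 55)) h1 (hne 11 (by norm_num) (by norm_num))
      (hne 5 (by norm_num) (by norm_num)) (hAk _)
  · exact no_aut_order_77 hV A h01 hsymm hdiag hk hsrg (σ ^ (orderOf σ / 77)) h1 (hne 11 (by norm_num) (by norm_num))
      (hne 7 (by norm_num) (by norm_num)) (hAk _)
  · exact no_aut_order_81 hV A h01 hsymm hdiag hk hsrg (σ ^ (orderOf σ / 81)) h1 (hne 27 (by norm_num) (by norm_num)) (hAk _)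
  · exact no_aut_order_105 hV A h01 hsymm hdiag hk hsrg (σ ^ (orderOf σ / 105)) h1 (hne 35 (by norm_num) (by norm_num))
      (hne 21 (by norm_num) (by norm_num)) (hne 15 (by norm_num) (by norm_num)) (hAk _)
  · have hb := aut_prime_pow_order_bound hV A h01 hsymm hdiag hk hsrg (σ ^ (orderOf σ / 1369)) (hAk _)
      (by norm_num : Nat.Prime 37) 1 (by norm_num [h1] : (σ ^ (orderOf σ / 1369)) ^ (37 ^ (1 + 1)) = 1)
      (by norm_num; exact hne 37 (by norm_num) (by norm_num))
    omega
  · have hb := aut_prime_pow_order_bound hV A h01 hsymm hdiag hk hsrg (σ ^ (orderOf σ / 1681)) (hAk _)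
      (by norm_num : Nat.Prime 41) 1 (by norm_num [h1] : (σ ^ (orderOf σ / 1681)) ^ (41 ^ (1 + 1)) = 1)
      (by norm_num; exact hne 41 (by norm_num) (by norm_num))
    omega
  · have hb := aut_prime_pow_order_bound hV A h01 hsymm hdiag hk hsrg (σ ^ (orderOf σ / 6889)) (hAk _)
      (by norm_num : Nat.Prime 83) 1 (by norm_num [h1] : (σ ^ (orderOf σ / 6889)) ^ (83 ^ (1 + 1)) = 1)
      (by norm_num; exact hne 83 (by norm_num) (by norm_num))
    omega

/-- **`orderOf σ ∣ 2⁶ · 3³ · 5 · 7 · 11 · 37 · 41 · 83`** for every automorphism `σ` of an `srg(333,166,82,83)`. -/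
theorem aut_orderOf_dvd_g30 (hV : Fintype.card V = 333) (A : Matrix V V ℤ)
    (h01 : ∀ x y, A x y = 0 ∨ A x y = 1) (hsymm : ∀ x y, A y x = A x y) (hdiag : ∀ x, A x x = 0)
    (hk : ∀ x, ∑ y, A x y = 166) (hsrg : ∀ x y, ∑ z, A x z * A z y = 83 * (1 + (if x = y then 1 else 0)) - A x y)
    (σ : Equiv.Perm V) (hA : ∀ x y, A (σ x) (σ y) = A x y) :
    orderOf σ ∣ 2 ^ 6 * 3 ^ 3 * 5 * 7 * 11 * 37 * 41 * 83 := by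
  have hnot29 := fun m hm => aut_orderOf_not_dvd hV A h01 hsymm hdiag hk hsrg σ hA (m := m) hm
  have hnot30 := fun m hm => aut_orderOf_not_dvd_g30 hV A h01 hsymm hdiag hk hsrg σ hA (m := m) hm
  rw [Nat.dvd_iff_prime_pow_dvd_dvd]
  intro p k hp hpk
  rcases Nat.eq_zero_or_pos k with rfl | hkpos
  · simp
  have hpd : p ∣ orderOf σ := (dvd_pow_self p hkpos.ne').trans hpk
  -- a bound `k ≤ b` from `¬ p^(b+1) ∣ orderOf σ`
  have bound : ∀ b : ℕ, ¬ p ^ (b + 1) ∣ orderOf σ → k ≤ b := fun b hb => by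
    by_contra hlt
    exact hb ((pow_dvd_pow p (by omega : b + 1 ≤ k)).trans hpk)
  rcases aut_prime_dvd_orderOf_g30 hV A h01 hsymm hdiag hk hsrg σ hA hp hpd with
    rfl | rfl | rfl | rfl | rfl | rfl | rfl | rfl
  · have hk6 := bound 6 (by simpa using hnot29 128 (by simp))
    exact (pow_dvd_pow 2 hk6).trans (by norm_num)
  · have hk3 := bound 3 (by simpa using hnot30 81 (by simp))
    exact (pow_dvd_pow 3 hk3).trans (by norm_num)
  · have hk1 := bound 1 (by simpa using hnot30 25 (by simp))
    exact (pow_dvd_pow 5 hk1).trans (by norm_num)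
  · have hk1 := bound 1 (by simpa using hnot29 49 (by simp))
    exact (pow_dvd_pow 7 hk1).trans (by norm_num)
  · have hk1 := bound 1 (by simpa using hnot29 121 (by simp))
    exact (pow_dvd_pow 11 hk1).trans (by norm_num)
  · have hk1 := bound 1 (by simpa using hnot30 1369 (by simp))
    exact (pow_dvd_pow 37 hk1).trans (by norm_num)
  · have hk1 := bound 1 (by simpa using hnot30 1681 (by simp))
    exact (pow_dvd_pow 41 hk1).trans (by norm_num)
  · have hk1 := bound 1 (by simpa using hnot30 6889 (by simp))
    exact (pow_dvd_pow 83 hk1).trans (by norm_num)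

end ordersummary30

end Summit.Ventures.DiscreteObjects.Hadamard
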